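import Literature.NumberTheory.Automorphic.UnitaryGroupAdelicCharactersArchType
import HarnessLib

/-!
# The twisted splitting character `χ₀ · α̃`: ∞-type `e₀ + 2m`, weight one, and CM type
# (Gelbart–Rogawski 1991 §3.1 Remark p. 457 read through Liu 2021 Def. 4.1 / 4.3)

Topic `NumberTheory/Automorphic`; namespace `Literature.NumberTheory.Automorphic.UnitaryGroup.AdelicCharactersArchType`
(sequel of `UnitaryGroupAdelicCharactersArchType`, whose § 3 gives the archimedean type `(2m, 0)` of the ratio character
`α̃ = ratioHecke α` of an automorphic character `α` of `U(1)(𝔸_{L⁺})` of archimedean type `m`).  KERNEL ONLY: proved theorems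
and two definitions with bodies (`twistedClassChar`, `twist`); 0 records, 0 named facts, 0 `sorry`.

* § 4 for a unitary Hecke character `χ₀` of unitary archimedean type `(e₀, 0)`: **`χ₀ · α̃` has type `(e₀ + 2m, 0)`**
  (`hasUnitaryArchType_mul_ratioHecke`); as a circle-valued idele CLASS character `twistedClassChar = [χ₀ · α̃]`
  (the currency `IdeleClassGroup L →ₜ* Circle` of [Liu2021] Def. 4.1–4.3 in the tree) it has ∞-type `e₀ + 2m`
  (`hasInfinityType_twistedClassChar`) and is CONJUGATE SYMPLECTIC when `χ₀` is a splitting character for `U(1)`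
  (`χ₀|_{𝕀_{L⁺}} = ε_{L/L⁺}`, [HarrisKudlaSweet1996, (1.5)]; `α̃|_{𝕀_{L⁺}} = 1`);
* § 5 ∞-type arithmetic for `|e₀| = 1`: `e₀ + 2m` has weight one iff `m_w ∈ {0, −e₀_w}` at every place
  (`weight_add_two_mul_eq_one_iff`), and then its CM type is that of `e₀` FLIPPED exactly at the places where `m_w ≠ 0`
  (`mem_cmTypeOf_add_two_mul_iff`); a character of weight one and CM type `Φ` has ∞-type `weightOneType Φ`
  (`hasInfinityType_weightOneType_of_hasWeight_one`);
* § 6 the **twist `μ₀ ⊛ α := [toHeckeCharacter μ₀ · α̃]`** of a class character `μ₀` of weight one and CM type `Φ₀`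
  (e.g. Liu's `μ(Φ, ι₁)`): conjugate symplectic iff `μ₀` is (`isConjugateSymplectic_twist_iff`), ∞-type
  `weightOneType Φ₀ + 2m` (`hasInfinityType_twist_weightOneType`), **WEIGHT ONE iff `m_w = 0 ∨ m_w = −(weightOneType Φ₀)_w`
  for all `w`** (`hasWeight_one_twist_iff`; spelled out: `m_w = 0`, or `m_w = 1` at `w.embedding ∈ Φ₀`, or `m_w = −1` at
  `w.embedding ∉ Φ₀`), and then **CM type = `Φ₀` flipped at `{w | m_w ≠ 0}`** (`hasCMType_twist`, `cmType_twist_eq`,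
  `mem_cmType_twist_iff'`: `φ ∈ Φ_{μ₀ ⊛ α} ↔ (m_{w(φ)} = 0 ↔ φ ∈ Φ₀)`).

Use (COR-CM cell, X3-Char residual (E)): at an index line `i` of the pin with splitting `chiSplittingLine (χ₀ · ratioHecke α_i)`,
`χ₀ = toHeckeCharacter μ₀`, the `Thm418Rest` slot `μ := μ₀ ⊛ α_i` has `toHeckeCharacter μ = χ₀ · α̃_i`
(`toHeckeCharacter_twist`), `isConjugateSymplectic` from `μ₀`'s, and `hasWeight_one` / `Φ_μ` from the exponents `m` of `α_i`
— WHICH `m` the pin's V-central archimedean type forces is the pin's (E-instance), not this file's.  Nothing of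
`ConjugateSelfDual*`, `IdeleClassCharacterHecke`, `HarrisKudlaSweet1996/SplittingCharactersCM` is restated.
HC_CM is NOT proved here or anywhere in the tree.

References: S. Gelbart, J. Rogawski, Invent. Math. 105 (1991), §3.1 Remark p. 457 [GelbartRogawski1991]; Y. Liu,
*Fourier–Jacobi cycles and arithmetic relative trace formula*, Camb. J. Math. 9 (2021), §4.1 Def. 4.1, Remark 4.2, Def. 4.3
[Liu2021]; M. Harris, S. Kudla, W. J. Sweet, J. Amer. Math. Soc. 9 (1996), (1.5) p. 951 [HarrisKudlaSweet1996]; A. Weil,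
*Basic Number Theory* (1967), Ch. VII §3 [WeilBNT1967].  Provenance: pub-hodgecm2 cell, seat item6-p3 (gen 11).
-/

set_option autoImplicit false

noncomputable section

open NumberField NumberField.InfinitePlace
open Literature.NumberTheory.GaloisRepresentations
open Literature.NumberTheory.GelbartRogawski1991.GRConstruction
open Literature.RepresentationTheory.HarrisKudlaSweet1996
open Literature.AlgebraicGeometry.Motives (CMType)

namespace Literature.NumberTheory.Automorphic

namespace UnitaryGroup

namespace AdelicCharactersArchType

variable (L : Type) [Field L] [NumberField L] [IsCMField L]

variable (α : adelicOne (maximalRealSubfield L) L (IsCMField.complexConj L) →* ℂˣ) (hα : Continuous α)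
  (hαrat : ∀ u : adelicOne (maximalRealSubfield L) L (IsCMField.complexConj L), (u : ideleGroup L) ∈ principalIdeles L → α u = 1)

/-! ## §4. The twisted splitting character `χ₀ · α̃`: unitary archimedean type `(e₀ + 2m, 0)` -/

omit [IsCMField L] in
/-- unitary archimedean types `(e, 0)` multiply: `(χ ψ)_∞ = χ_∞ ψ_∞`. [cite: Patrikis2019, §2.1] -/
theorem _root_.Literature.NumberTheory.GaloisRepresentations.HeckeCharacter.HasUnitaryArchType.mul_zero_right
    {χ ψ : HeckeCharacter L} {e e' : InfinitePlace L → ℤ}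
    (hχ : χ.HasUnitaryArchType e fun _ => 0) (hψ : ψ.HasUnitaryArchType e' fun _ => 0) :
    (χ * ψ).HasUnitaryArchType (fun w => e w + e' w) fun _ => 0 := by
  intro x
  rw [HeckeCharacter.mul_apply, Units.val_mul, hχ x, hψ x, ← Finset.prod_mul_distrib]
  refine Finset.prod_congr rfl fun w _ => ?_
  have hx0 : Completion.extensionEmbedding w ((x : InfiniteAdeleRing L) w) ≠ 0 := by
    rw [map_ne_zero]
    exact GaloisRepresentations.InfiniteIdele.coe_apply_ne_zero x w
  have hx0' : Completion.extensionEmbedding w ((x : InfiniteAdeleRing L) w) /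
      (‖Completion.extensionEmbedding w ((x : InfiniteAdeleRing L) w)‖ : ℂ) ≠ 0 :=
    div_ne_zero hx0 (by exact_mod_cast norm_ne_zero_iff.2 hx0)
  simp only [HeckeCharacter.CMQuadraticExtension.archUnitaryValue_zero_right]
  rw [zpow_add₀ hx0']

variable (χ₀ : HeckeCharacter L) (hχ₀u : χ₀.IsUnitary) {e₀ : InfinitePlace L → ℤ}

/-- **the ∞-type of the twisted splitting character**: if `χ₀` has unitary archimedean type `(e₀, 0)` and `α` has
archimedean type `m`, then `χ₀ · α̃` has unitary archimedean type `(e₀ + 2m, 0)`. [cite: GelbartRogawski1991, §3.1 Remark p. 457 L4–13] -/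
theorem hasUnitaryArchType_mul_ratioHecke (hχ₀ : χ₀.HasUnitaryArchType e₀ fun _ => 0) {m : InfinitePlace L → ℤ}
    (hm : UnitaryLineChar.HasArchType L (lineCharOf L α hα hαrat) m) :
    (χ₀ * DoubledWeilDetTwist.ratioHecke L α hα hαrat).HasUnitaryArchType (fun w => e₀ w + 2 * m w) fun _ => 0 :=
  hχ₀.mul_zero_right L (hasUnitaryArchType_ratioHecke_of_hasArchType L α hα hαrat hm)

include hα hαrat hχ₀u in
/-- `χ₀ · α̃` is unitary. [cite: Godement1964, §5 Thm. 4] -/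
theorem isUnitary_mul_ratioHecke : (χ₀ * DoubledWeilDetTwist.ratioHecke L α hα hαrat).IsUnitary :=
  DoubledWeilDetTwist.isUnitary_mul_ratioHecke L hχ₀u hα hαrat (cm_norm_apply_eq_one_of_trivial_on_principal L α hα hαrat)

/-- **the twisted character in idele-CLASS currency**: `μ := [χ₀ · α̃] : C_L →ₜ* S¹` (the `Thm418Rest.μ` slot is typed
`IdeleClassGroup E →ₜ* Circle`). [cite: WeilBNT1967, Ch. VII §3] -/
def twistedClassChar : IdeleClassGroup L →ₜ* Circle :=
  unitaryClassChar L (χ₀ * DoubledWeilDetTwist.ratioHecke L α hα hαrat)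
    (isUnitary_mul_ratioHecke L α hα hαrat χ₀ hχ₀u)

/-- `toHeckeCharacter μ = χ₀ · α̃`: the class character IS the twisted splitting character. [cite: WeilBNT1967, Ch. VII §3] -/
@[simp] theorem toHeckeCharacter_twistedClassChar :
    IdeleClassGroup.toHeckeCharacter L (twistedClassChar L α hα hαrat χ₀ hχ₀u) =
      χ₀ * DoubledWeilDetTwist.ratioHecke L α hα hαrat :=
  toHeckeCharacter_unitaryClassChar L _ _

/-- values: `μ [d] = χ₀ d · α (d / d̄)`. [cite: GelbartRogawski1991, §3.1 Remark p. 457 L4–13] -/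
theorem coe_twistedClassChar_mk (d : ideleGroup L) :
    ((twistedClassChar L α hα hαrat χ₀ hχ₀u (d : IdeleClassGroup L) : Circle) : ℂ) =
      ((χ₀ d : ℂˣ) : ℂ) * ((α (DoubledWeilDetTwist.idelesRatio L d) : ℂˣ) : ℂ) := by
  rw [twistedClassChar, coe_unitaryClassChar_mk, DoubledWeilDetTwist.mul_ratioHecke_apply,
    Units.val_mul]

/-- **∞-type of `μ = [χ₀ · α̃]`**: `e₀ + 2m`. [cite: GelbartRogawski1991, §3.1 Remark p. 457 L4–13] -/
theorem hasInfinityType_twistedClassChar (hχ₀ : χ₀.HasUnitaryArchType e₀ fun _ => 0) {m : InfinitePlace L → ℤ}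
    (hm : UnitaryLineChar.HasArchType L (lineCharOf L α hα hαrat) m) :
    IdeleClassGroup.HasInfinityType L (twistedClassChar L α hα hαrat χ₀ hχ₀u) fun w => e₀ w + 2 * m w :=
  (hasUnitaryArchType_iff_hasInfinityType_unitaryClassChar L _ _ _).1
    (hasUnitaryArchType_mul_ratioHecke L α hα hαrat χ₀ hχ₀ hm)

/-- **`μ = [χ₀ · α̃]` is conjugate symplectic when `χ₀` is a splitting character for `U(1)`** (`χ₀|_{𝕀_{L⁺}} = ε_{L/L⁺}`,
[HarrisKudlaSweet1996, (1.5)]): `α̃` is trivial on `𝕀_{L⁺}` (`isSplittingChar_mul_ratioHecke_iff`), and a unitary splitting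
character for odd `m = 1` is conjugate symplectic ([Liu2021] Def. 4.1). [cite: Liu2021, Def. 4.1] -/
theorem isConjugateSymplectic_twistedClassChar (hχ₀s : IsSplittingChar L 1 χ₀) :
    IdeleClassGroup.IsConjugateSymplectic L (twistedClassChar L α hα hαrat χ₀ hχ₀u) :=
  IsSplittingChar.isConjugateSymplectic odd_one _
    ((DoubledWeilDetTwist.isSplittingChar_mul_ratioHecke_iff L 1 χ₀ hα hαrat).2 hχ₀s)


/-! ## §5. ∞-type arithmetic: weight and CM type of `e₀ + 2m` for `e₀` of weight one -/

section InfinityTypeArithmetic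

variable {e₀ m : InfinitePlace L → ℤ}

omit [NumberField L] [IsCMField L] in
/-- for `|e₀_w| = 1`: `|e₀_w + 2 m_w| = 1` for every `w` iff `m_w ∈ {0, −e₀_w}` for every `w` ([Liu2021] Def. 4.3: the weight `𝔴_w = |e_w|`). [cite: Liu2021, Def. 4.3] -/
theorem weight_add_two_mul_eq_one_iff (h1 : IdeleClassGroup.weight e₀ = 1) :
    IdeleClassGroup.weight (fun w => e₀ w + 2 * m w) = 1 ↔ ∀ w, m w = 0 ∨ m w = -e₀ w := by
  constructor
  · intro h w
    have a := congrFun h1 w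
    have b := congrFun h w
    simp only [IdeleClassGroup.weight_apply, Pi.one_apply] at a b
    omega
  · intro h
    funext w
    have a := congrFun h1 w
    simp only [IdeleClassGroup.weight_apply, Pi.one_apply] at a ⊢
    rcases h w with h0 | h0 <;> omega

omit [NumberField L] [IsCMField L] in
/-- under the weight-one alternative the ∞-type `e₀ + 2m` is zero-free ([Liu2021] Remark 4.2). [cite: Liu2021, Remark 4.2] -/
theorem add_two_mul_ne_zero (he₀ : ∀ w, e₀ w ≠ 0) (hm : ∀ w, m w = 0 ∨ m w = -e₀ w) (w : InfinitePlace L) :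
    e₀ w + 2 * m w ≠ 0 := by
  rcases hm w with h0 | h0
  · rw [h0, mul_zero, add_zero]; exact he₀ w
  · rw [h0, mul_neg, two_mul, neg_add, ← add_assoc, add_neg_cancel, zero_add, neg_ne_zero]; exact he₀ w

/-- **the CM type of `e₀ + 2m` is the CM type of `e₀` FLIPPED exactly at the places where `m ≠ 0`**: for `|e₀| = 1` and
`m_w ∈ {0, −e₀_w}`, an embedding `φ` lies in `Φ_{e₀ + 2m}` iff (`m_{w(φ)} = 0` ↔ `φ ∈ Φ_{e₀}`) ([Liu2021] Def. 4.3: `Φ_μ` = the coordinates with negative exponent). [cite: Liu2021, Def. 4.3] -/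
theorem mem_cmTypeOf_add_two_mul_iff (h1 : IdeleClassGroup.weight e₀ = 1) (he₀ : ∀ w, e₀ w ≠ 0)
    (hm : ∀ w, m w = 0 ∨ m w = -e₀ w) (he : ∀ w, e₀ w + 2 * m w ≠ 0) (φ : L →+* ℂ) :
    φ ∈ (IdeleClassGroup.cmTypeOf L (fun w => e₀ w + 2 * m w) he).1 ↔
      (m (InfinitePlace.mk φ) = 0 ↔ φ ∈ (IdeleClassGroup.cmTypeOf L e₀ he₀).1) := by
  simp only [IdeleClassGroup.mem_cmTypeOf_iff, IdeleClassGroup.exponentAt]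
  have a := congrFun h1 (InfinitePlace.mk φ)
  simp only [IdeleClassGroup.weight_apply, Pi.one_apply] at a
  have b := he₀ (InfinitePlace.mk φ)
  rcases hm (InfinitePlace.mk φ) with h0 | h0 <;> split_ifs <;> omega

/-- a zero-free ∞-type of weight one IS the weight-one type of its CM type: `e = weightOneType Φ_e`. [cite: Liu2021, Def. 4.3] -/
theorem eq_weightOneType_of_weight_eq_one {e : InfinitePlace L → ℤ} (he : ∀ w, e w ≠ 0)
    (h1 : IdeleClassGroup.weight e = 1) {Φ : CMType L} (hΦ : IdeleClassGroup.cmTypeOf L e he = Φ) :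
    e = IdeleClassGroup.weightOneType L Φ := by
  funext w
  have a := congrFun h1 w
  simp only [IdeleClassGroup.weight_apply, Pi.one_apply] at a
  have hmem : w.embedding ∈ Φ.1 ↔ e w < 0 := by
    rw [← hΦ]
    exact IdeleClassGroup.embedding_mem_cmTypeOf_iff
  unfold IdeleClassGroup.weightOneType
  split_ifs with h
  · have := hmem.1 h
    omega
  · have := mt hmem.2 h
    omega

/-- **a character of weight one and CM type `Φ` has ∞-type `weightOneType Φ`** (converse of the tree's packaging
`exists_isConjugateSymplectic_hasCMType`). [cite: Liu2021, Def. 4.3] -/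
theorem hasInfinityType_weightOneType_of_hasWeight_one {ψ : IdeleClassGroup L →ₜ* Circle} {Φ : CMType L}
    (hw : IdeleClassGroup.HasWeight L ψ 1) (hΦ : IdeleClassGroup.HasCMType L ψ Φ) :
    IdeleClassGroup.HasInfinityType L ψ (IdeleClassGroup.weightOneType L Φ) := by
  obtain ⟨e, he0, he, hΦe⟩ := hΦ
  obtain ⟨e', he', hw'⟩ := hw
  obtain rfl := IdeleClassGroup.hasInfinityType_unique he he'
  rwa [← eq_weightOneType_of_weight_eq_one L he0 hw' hΦe]

end InfinityTypeArithmetic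

/-! ## §6. The twist `μ₀ ⊛ α := [toHecke μ₀ · α̃]` of a weight-one class character: weight one and CM type -/

section Twist

variable (μ₀ : IdeleClassGroup L →ₜ* Circle)

/-- **the twist of a class character `μ₀` by `α`**: the class character of the Hecke character `μ₀ · α̃`
(`μ [d] = μ₀ [d] · α (d / d̄)`) — the `μ_i = χ₀ · α̃_i` of the COR-CM pin's index lines, `χ₀ = toHeckeCharacter μ₀`. [cite: GelbartRogawski1991, §3.1 Remark p. 457 L4–13] -/
def twist : IdeleClassGroup L →ₜ* Circle :=
  twistedClassChar L α hα hαrat (IdeleClassGroup.toHeckeCharacter L μ₀) (IdeleClassGroup.isUnitary_toHeckeCharacter L μ₀)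

/-- `toHeckeCharacter (μ₀ ⊛ α) = toHeckeCharacter μ₀ · α̃`. [cite: GelbartRogawski1991, §3.1 Remark p. 457 L4–13] -/
@[simp] theorem toHeckeCharacter_twist :
    IdeleClassGroup.toHeckeCharacter L (twist L α hα hαrat μ₀) =
      IdeleClassGroup.toHeckeCharacter L μ₀ * DoubledWeilDetTwist.ratioHecke L α hα hαrat :=
  toHeckeCharacter_twistedClassChar L α hα hαrat _ _

/-- values: `(μ₀ ⊛ α) [d] = μ₀ [d] · α (d / d̄)`. [cite: GelbartRogawski1991, §3.1 Remark p. 457 L4–13] -/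
theorem coe_twist_mk (d : ideleGroup L) :
    ((twist L α hα hαrat μ₀ (d : IdeleClassGroup L) : Circle) : ℂ) =
      ((μ₀ (d : IdeleClassGroup L) : Circle) : ℂ) * ((α (DoubledWeilDetTwist.idelesRatio L d) : ℂˣ) : ℂ) := by
  rw [twist, coe_twistedClassChar_mk, IdeleClassGroup.coe_toHeckeCharacter_apply]

/-- **`μ₀ ⊛ α` is conjugate symplectic iff `μ₀` is** (`α̃|_{𝕀_{L⁺}} = 1`). [cite: Liu2021, Def. 4.1] -/
theorem isConjugateSymplectic_twist_iff :
    IdeleClassGroup.IsConjugateSymplectic L (twist L α hα hαrat μ₀) ↔ IdeleClassGroup.IsConjugateSymplectic L μ₀ := by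
  rw [← isSplittingChar_toHeckeCharacter_iff_isConjugateSymplectic odd_one,
    ← isSplittingChar_toHeckeCharacter_iff_isConjugateSymplectic odd_one, toHeckeCharacter_twist,
    DoubledWeilDetTwist.isSplittingChar_mul_ratioHecke_iff]

/-- **∞-type of the twist**: `e₀ + 2m` for `μ₀` of ∞-type `e₀` and `α` of archimedean type `m`. [cite: GelbartRogawski1991, §3.1 Remark p. 457 L4–13] -/
theorem hasInfinityType_twist {e₀ : InfinitePlace L → ℤ} (he₀ : IdeleClassGroup.HasInfinityType L μ₀ e₀)
    {m : InfinitePlace L → ℤ} (hm : UnitaryLineChar.HasArchType L (lineCharOf L α hα hαrat) m) :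
    IdeleClassGroup.HasInfinityType L (twist L α hα hαrat μ₀) fun w => e₀ w + 2 * m w :=
  hasInfinityType_twistedClassChar L α hα hαrat _ _
    ((IdeleClassGroup.hasUnitaryArchType_toHeckeCharacter_iff L μ₀ e₀).2 he₀) hm

/-- the same with `m := archType α` supplied by the classification ([BrockerTomDieck1985] II 8.1). [cite: BrockerTomDieck1985, Ch. II Prop. 8.1] -/
theorem hasInfinityType_twist_archType {e₀ : InfinitePlace L → ℤ} (he₀ : IdeleClassGroup.HasInfinityType L μ₀ e₀) :
    IdeleClassGroup.HasInfinityType L (twist L α hα hαrat μ₀)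
      fun w => e₀ w + 2 * UnitaryLineChar.archType L (lineCharOf L α hα hαrat) w :=
  hasInfinityType_twist L α hα hαrat μ₀ he₀ (UnitaryLineChar.hasArchType_archType L _)

/-- **trivial archimedean type**: if `α (t, 1) = 1` on `U(1)(L⁺ ⊗ ℝ)` then the twist `μ₀ ⊛ α` has the SAME ∞-type as `μ₀`.
[cite: GelbartRogawski1991, §3.1 Remark p. 457 L4–13] -/
theorem hasInfinityType_twist_of_arch_eq_one {e₀ : InfinitePlace L → ℤ} (he₀ : IdeleClassGroup.HasInfinityType L μ₀ e₀)
    (h1 : ∀ t : relNormOneInfUnits (maximalRealSubfield L) L,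
      α ((cmAdelicOneEquivRelNormOne L).symm (relNormOneInfToIdeles (maximalRealSubfield L) L t)) = 1) :
    IdeleClassGroup.HasInfinityType L (twist L α hα hαrat μ₀) e₀ := by
  have h := hasInfinityType_twist L α hα hαrat μ₀ he₀ ((hasArchType_lineCharOf_zero_iff L α hα hαrat).2 h1)
  simp only [Pi.zero_apply, mul_zero, add_zero] at h
  exact h

/-- … hence the same weight. [cite: Liu2021, Def. 4.3] -/
theorem hasWeight_twist_of_arch_eq_one {𝔴 : InfinitePlace L → ℕ} (hw : IdeleClassGroup.HasWeight L μ₀ 𝔴)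
    (h1 : ∀ t : relNormOneInfUnits (maximalRealSubfield L) L,
      α ((cmAdelicOneEquivRelNormOne L).symm (relNormOneInfToIdeles (maximalRealSubfield L) L t)) = 1) :
    IdeleClassGroup.HasWeight L (twist L α hα hαrat μ₀) 𝔴 := by
  obtain ⟨e, he, rfl⟩ := hw
  exact ⟨e, hasInfinityType_twist_of_arch_eq_one L α hα hαrat μ₀ he h1, rfl⟩

/-- … and the same CM type. [cite: Liu2021, Def. 4.3] -/
theorem hasCMType_twist_of_arch_eq_one {Φ : CMType L} (hΦ : IdeleClassGroup.HasCMType L μ₀ Φ)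
    (h1 : ∀ t : relNormOneInfUnits (maximalRealSubfield L) L,
      α ((cmAdelicOneEquivRelNormOne L).symm (relNormOneInfToIdeles (maximalRealSubfield L) L t)) = 1) :
    IdeleClassGroup.HasCMType L (twist L α hα hαrat μ₀) Φ := by
  obtain ⟨e, he0, he, rfl⟩ := hΦ
  exact ⟨e, he0, hasInfinityType_twist_of_arch_eq_one L α hα hαrat μ₀ he h1, rfl⟩

/-- … so for conjugate symplectic `μ₀`: `Φ_{μ₀ ⊛ α} = Φ_{μ₀}` as `cmType` FUNCTIONS (any proofs). [cite: Liu2021, Def. 4.3] -/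
theorem cmType_twist_eq_of_arch_eq_one (h : IdeleClassGroup.IsConjugateSymplectic L (twist L α hα hαrat μ₀))
    (hμ₀ : IdeleClassGroup.IsConjugateSymplectic L μ₀)
    (h1 : ∀ t : relNormOneInfUnits (maximalRealSubfield L) L,
      α ((cmAdelicOneEquivRelNormOne L).symm (relNormOneInfToIdeles (maximalRealSubfield L) L t)) = 1) :
    h.cmType = hμ₀.cmType :=
  h.cmType_eq (hasCMType_twist_of_arch_eq_one L α hα hαrat μ₀ hμ₀.hasCMType_cmType h1)

variable {Φ₀ : CMType L} {m : InfinitePlace L → ℤ}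

/-- **∞-type of the twist of a weight-one character of CM type `Φ₀`**: `weightOneType Φ₀ + 2m`. [cite: Liu2021, Def. 4.3] -/
theorem hasInfinityType_twist_weightOneType (hw : IdeleClassGroup.HasWeight L μ₀ 1) (hΦ : IdeleClassGroup.HasCMType L μ₀ Φ₀)
    (hm : UnitaryLineChar.HasArchType L (lineCharOf L α hα hαrat) m) :
    IdeleClassGroup.HasInfinityType L (twist L α hα hαrat μ₀) fun w => IdeleClassGroup.weightOneType L Φ₀ w + 2 * m w :=
  hasInfinityType_twist L α hα hαrat μ₀ (hasInfinityType_weightOneType_of_hasWeight_one L hw hΦ) hm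

/-- **WEIGHT ONE CRITERION**: for `μ₀` of weight one and CM type `Φ₀` and `α` of archimedean type `m`, the twist `μ₀ ⊛ α` has
weight one ([Liu2021] Def. 4.3 (1), the `hasWeight_one` field of `Thm418Rest`) **iff** at every place `m_w = 0` or
`m_w = −(weightOneType Φ₀)_w` (i.e. `m_w = 1` if `w.embedding ∈ Φ₀`, `m_w = −1` otherwise). [cite: Liu2021, Def. 4.3 (1)] -/
theorem hasWeight_one_twist_iff (hw : IdeleClassGroup.HasWeight L μ₀ 1) (hΦ : IdeleClassGroup.HasCMType L μ₀ Φ₀)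
    (hm : UnitaryLineChar.HasArchType L (lineCharOf L α hα hαrat) m) :
    IdeleClassGroup.HasWeight L (twist L α hα hαrat μ₀) 1 ↔
      ∀ w, m w = 0 ∨ m w = -IdeleClassGroup.weightOneType L Φ₀ w := by
  have ht := hasInfinityType_twist_weightOneType L α hα hαrat μ₀ hw hΦ hm
  rw [← weight_add_two_mul_eq_one_iff L (IdeleClassGroup.weight_weightOneType Φ₀)]
  constructor
  · rintro ⟨e, he, hwe⟩
    obtain rfl := IdeleClassGroup.hasInfinityType_unique he ht
    exact hwe
  · intro h
    exact ⟨_, ht, h⟩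

omit [NumberField L] [IsCMField L] in
/-- the weight-one alternative spelled out on `Φ₀`: `m_w = 0`, or `m_w = 1` and `w.embedding ∈ Φ₀`, or `m_w = −1` and
`w.embedding ∉ Φ₀`. [cite: Liu2021, Def. 4.3] -/
theorem eq_zero_or_eq_neg_weightOneType_iff (w : InfinitePlace L) :
    (m w = 0 ∨ m w = -IdeleClassGroup.weightOneType L Φ₀ w) ↔
      (m w = 0 ∨ (w.embedding ∈ Φ₀.1 ∧ m w = 1) ∨ (w.embedding ∉ Φ₀.1 ∧ m w = -1)) := by
  unfold IdeleClassGroup.weightOneType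
  split_ifs with h <;> simp [h]

/-- **CM TYPE OF THE TWIST**: under the weight-one alternative, `μ₀ ⊛ α` has the CM type `Φ_{weightOneType Φ₀ + 2m}`, whose
members are described by `mem_cmType_twist_iff` (= `Φ₀` flipped at the places where `m ≠ 0`). [cite: Liu2021, Def. 4.3 (2)] -/
theorem hasCMType_twist (hw : IdeleClassGroup.HasWeight L μ₀ 1) (hΦ : IdeleClassGroup.HasCMType L μ₀ Φ₀)
    (hm : UnitaryLineChar.HasArchType L (lineCharOf L α hα hαrat) m)
    (h1 : ∀ w, m w = 0 ∨ m w = -IdeleClassGroup.weightOneType L Φ₀ w) :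
    IdeleClassGroup.HasCMType L (twist L α hα hαrat μ₀)
      (IdeleClassGroup.cmTypeOf L (fun w => IdeleClassGroup.weightOneType L Φ₀ w + 2 * m w)
        (add_two_mul_ne_zero L (IdeleClassGroup.weightOneType_ne_zero Φ₀) h1)) :=
  IdeleClassGroup.hasCMType_cmTypeOf (hasInfinityType_twist_weightOneType L α hα hαrat μ₀ hw hΦ hm) _

/-- **membership in the CM type of the twist**: `φ ∈ Φ_{μ₀ ⊛ α}` iff (`m_{w(φ)} = 0` ↔ `φ ∈ Φ₀`) — the CM type `Φ₀` of `μ₀`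
FLIPPED exactly at the places `w` with `m_w ≠ 0`. [cite: Liu2021, Def. 4.3 (2)] -/
theorem mem_cmType_twist_iff (h1 : ∀ w, m w = 0 ∨ m w = -IdeleClassGroup.weightOneType L Φ₀ w) (φ : L →+* ℂ) :
    φ ∈ (IdeleClassGroup.cmTypeOf L (fun w => IdeleClassGroup.weightOneType L Φ₀ w + 2 * m w)
        (add_two_mul_ne_zero L (IdeleClassGroup.weightOneType_ne_zero Φ₀) h1)).1 ↔
      (m (InfinitePlace.mk φ) = 0 ↔ φ ∈ Φ₀.1) := by
  rw [mem_cmTypeOf_add_two_mul_iff L (IdeleClassGroup.weight_weightOneType Φ₀) (IdeleClassGroup.weightOneType_ne_zero Φ₀) h1,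
    IdeleClassGroup.mem_cmTypeOf_weightOneType_iff]

/-- **the CM type as the `cmType` FUNCTION of the conjugate-symplectic twist** (the form `Thm418Data.cmType` reads):
for `μ₀` conjugate symplectic of weight one and CM type `Φ₀`, `(μ₀ ⊛ α)` is conjugate symplectic and its `cmType` is
`Φ_{weightOneType Φ₀ + 2m}`. [cite: Liu2021, Def. 4.3 (2)] -/
theorem cmType_twist_eq (hμ₀ : IdeleClassGroup.IsConjugateSymplectic L μ₀) (hw : IdeleClassGroup.HasWeight L μ₀ 1)
    (hΦ : IdeleClassGroup.HasCMType L μ₀ Φ₀) (hm : UnitaryLineChar.HasArchType L (lineCharOf L α hα hαrat) m)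
    (h1 : ∀ w, m w = 0 ∨ m w = -IdeleClassGroup.weightOneType L Φ₀ w) :
    ((isConjugateSymplectic_twist_iff L α hα hαrat μ₀).2 hμ₀).cmType =
      IdeleClassGroup.cmTypeOf L (fun w => IdeleClassGroup.weightOneType L Φ₀ w + 2 * m w)
        (add_two_mul_ne_zero L (IdeleClassGroup.weightOneType_ne_zero Φ₀) h1) :=
  IdeleClassGroup.IsConjugateSymplectic.cmType_eq _ (hasCMType_twist L α hα hαrat μ₀ hw hΦ hm h1)

/-- **membership in `cmType` of the twist, for ANY proof of conjugate-symplecticity** (proof-irrelevant; the shape in which a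
structure field `isConjugateSymplectic` is met): `φ ∈ Φ_{μ₀ ⊛ α} ↔ (m_{w(φ)} = 0 ↔ φ ∈ Φ₀)`. [cite: Liu2021, Def. 4.3 (2)] -/
theorem mem_cmType_twist_iff' (h : IdeleClassGroup.IsConjugateSymplectic L (twist L α hα hαrat μ₀))
    (hw : IdeleClassGroup.HasWeight L μ₀ 1) (hΦ : IdeleClassGroup.HasCMType L μ₀ Φ₀)
    (hm : UnitaryLineChar.HasArchType L (lineCharOf L α hα hαrat) m)
    (h1 : ∀ w, m w = 0 ∨ m w = -IdeleClassGroup.weightOneType L Φ₀ w) (φ : L →+* ℂ) :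
    φ ∈ h.cmType.1 ↔ (m (InfinitePlace.mk φ) = 0 ↔ φ ∈ Φ₀.1) := by
  rw [h.cmType_eq (hasCMType_twist L α hα hαrat μ₀ hw hΦ hm h1)]
  exact mem_cmType_twist_iff L h1 φ

end Twist

end AdelicCharactersArchType

end UnitaryGroup

end Literature.NumberTheory.Automorphic

end
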